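import Mathlib
import HarnessLib
import Literature.MathematicalPhysics.StatisticalMechanics.LennardJonesClusters
import Summits.AtomisticToContinuum.Crystallization.Theorems.ContactSaturationLadderWindowFloor
import Summits.AtomisticToContinuum.Crystallization.Theorems.ContactSaturationLadderHoleDepth

/-!
# ContactSaturationLadderHaloCount — the loose/deep/cored vocabulary of crux `LooseTextureRung` and the GS-free brush-and-shell count (helper, supports item 30303; part 1 of 2)

Helper for route `ContactSaturationLadder` (sub-problem `Crystallization`), crux `LooseTextureRung`
(stmt-AtomisticToContinuum-30303, DECLARED RESIDUAL-CORE), registered line «DialFreeSieve» v5 (lens-1 lineage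
`decomp-a2c-lens-1`, cell `decomp-a2c`).  LANDING AUTHORISED by the cell critic (`decomp-a2c-crit-1`, CRITIC-LEDGER rows 198 (iii) and 208,
bus STATUS l.1094 / l.1122: «PRE-CLEARED FOR LANDING as a helper»).  This is PART 1 (vocabulary + species + the GS-free count); PART 2
`ContactSaturationLadderHaloChart` (floors by grade, halo law, affine two-shell chart) imports it.  Nothing here is a registered item; the
registered skeleton v5 (`stub_thinClusterFloor8` etc.) is untouched.  Every statement below is PROVED (0 sorry); the `def`s are the
lineage's vocabulary, verbatim the text inlined in the tree item (the item's `LooseBallDense (3/50)` hypothesis unfolds to `looseSet (3/50)`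
below by `Iff.rfl`, checked in the lineage's node files).

§1 **Vocabulary.** `UniformlyTight δ d y j` (the radius-5 ball about `y j` is a δ-quasi-twelve-neighbour packing at the common scale
`d ∈ [3/4, 6/5]`), the δ-LOOSE set `looseSet δ y` (no uniformly tight 5-ball at any scale), the `r`-DEEP loose set `deepSet r y` (loose, and
every particle within `r` is loose), the `R`-void-adjacent set `voidAdjSet R y`, the internal energy `intEnergy y W` of a sub-cluster and its
order-0 floor `#W·e⋆ ≤ 𝓔(y|W)` (`intEnergy_floor` = TREE `ContactSaturationLadderWindowFloor.card_mul_iInf_le_half_sum`; `e⋆ =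
ChargedEnergyGapNegative.eStar`).

§2 **Species and the GS-free count.** The CORED loose particles `coredSet R y` (a 5-deep particle within `R`) and the CORELESS ones
`corelessSet R y`; they count the loose particles of any window exactly (`card_cored_add_coreless`).  A pair closer than `3/4` makes both ends
5-deep (`mem_deepSet_of_shortPair`), so non-5-deep particles are `3/4`-separated (`sep_of_not_mem_deepSet5`); hence, by the TREE brush count
`ContactSaturationLadderHoleDepth.card_le_mul_card_of_brushed` (reach 6, separation 3/4: `17³ = 4913` per core) and volume packing in the
boundary shell (`card_shell_le`: `≤ 500ρ²`), in ANY configuration and any ball `B(p,ρ)`, `ρ ≥ 9`: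
`#cored₆(B_ρ) ≤ 4914·#deep₅(B_ρ) + 500ρ²` (`card_cored6_le`).
-/

noncomputable section

open scoped BigOperators Classical
open MeasureTheory Metric
open Literature.MathematicalPhysics.StatisticalMechanics (lennardJones IsGroundState PeriodicConfiguration)
open Summit.AtomisticToContinuum.Crystallization.Theorems.ChargedEnergyGapNegative (eStar)
open Summit.AtomisticToContinuum.Crystallization.Theorems

namespace Summit.AtomisticToContinuum.Crystallization.Theorems.ContactSaturationLadderHaloCount

variable {N : ℕ}

/-! ## §1 Vocabulary -/

/-- `UniformlyTight δ d y j` (gen 5): the radius-5 ball around `y j` is a δ-QUASI-TWELVE-NEIGHBOUR PACKING at the common scale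
`d ∈ [3/4, 6/5]`. -/
def UniformlyTight (δ d : ℝ) {N : ℕ} (y : Fin N → EuclideanSpace ℝ (Fin 3)) (j : Fin N) : Prop :=
  3 / 4 ≤ d ∧ d ≤ 6 / 5 ∧ (∀ k l : Fin N, k ≠ l → dist (y k) (y j) ≤ 6 → dist (y l) (y j) ≤ 6 → d ≤ dist (y k) (y l)) ∧ (∀ k : Fin N, dist (y k) (y j) ≤ 5 → 12 ≤ (Finset.univ.filter fun l => l ≠ k ∧ dist (y l) (y k) ≤ (1 + δ) * d).card)

/-- The δ-LOOSE particles of a configuration: those with no uniformly δ-tight 5-ball at any scale. -/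
def looseSet (δ : ℝ) {N : ℕ} (y : Fin N → EuclideanSpace ℝ (Fin 3)) : Finset (Fin N) :=
  Finset.univ.filter fun j : Fin N => ∀ d : ℝ, ¬ UniformlyTight δ d y j

/-- Separation at a tight centre: a particle that is NOT δ-loose is at distance `≥ 3/4` from every other particle. -/
theorem sep_of_not_mem_looseSet {δ : ℝ} {N : ℕ} {y : Fin N → EuclideanSpace ℝ (Fin 3)} {i : Fin N}
    (hi : i ∉ looseSet δ y) (j : Fin N) (hji : j ≠ i) : (3 / 4 : ℝ) ≤ dist (y i) (y j) := by
  simp only [looseSet, Finset.mem_filter, Finset.mem_univ, true_and, not_forall, not_not] at hi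
  obtain ⟨d, hd34, -, hsep, -⟩ := hi
  rw [dist_comm]
  by_cases h6 : dist (y j) (y i) ≤ 6
  · exact le_trans hd34 (hsep j i hji h6 (by rw [dist_self]; norm_num))
  · linarith

/-- **`deepSet r y`** — the r-DEEP (3/50)-loose particles: loose particles `j` such that EVERY particle of the configuration within `r`
of `y j` is (3/50)-loose too (the closed r-ball about `y j` meets no tight 5-ball centre).  `r ↦ deepSet r y` is antitone; its density
profile in `r` is the inradius spectrum of the loose set: point/line/wall defects and thin films have depth `< 5 + (half core width)`,
bulk amorphous / tetrahedrally close-packed chunks of diameter `D` have depth `≈ D/2`. -/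
def deepSet (r : ℝ) {N : ℕ} (y : Fin N → EuclideanSpace ℝ (Fin 3)) : Finset (Fin N) :=
  (looseSet (3 / 50) y).filter fun j : Fin N => ∀ k : Fin N, dist (y k) (y j) ≤ r → k ∈ looseSet (3 / 50) y

/-- `r`-deep loose particles are loose. -/
theorem deepSet_subset_looseSet (r : ℝ) {N : ℕ} (y : Fin N → EuclideanSpace ℝ (Fin 3)) :
    deepSet r y ⊆ looseSet (3 / 50) y :=
  Finset.filter_subset _ _

/-- Antitone in the depth: a deeper-loose particle is deep-loose. -/
theorem deepSet_anti {r r' : ℝ} (h : r ≤ r') {N : ℕ} (y : Fin N → EuclideanSpace ℝ (Fin 3)) :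
    deepSet r' y ⊆ deepSet r y := by
  intro j hj
  simp only [deepSet, Finset.mem_filter] at hj ⊢
  exact ⟨hj.1, fun k hk => hj.2 k (le_trans hk h)⟩

/-- The `R`-VOID-ADJACENT particles: those with an EMPTY unit ball (no particle at distance `< 1` from its centre) centred within `R`.
`VoidSparse` says exactly that these are `o(N)` for every `R`. -/
def voidAdjSet (R : ℝ) {N : ℕ} (y : Fin N → EuclideanSpace ℝ (Fin 3)) : Finset (Fin N) :=
  Finset.univ.filter fun i : Fin N => ∃ c : EuclideanSpace ℝ (Fin 3), dist c (y i) ≤ R ∧ ∀ j : Fin N, 1 ≤ dist c (y j)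

/-- **Internal energy** of the sub-cluster indexed by `W`: `𝓔(y|W) = ½ Σ_{i∈W} Σ_{k∈W∖{i}} V_LJ(|y_i − y_k|)`. -/
def intEnergy {N : ℕ} (y : Fin N → EuclideanSpace ℝ (Fin 3)) (W : Finset (Fin N)) : ℝ :=
  (1 / 2) * ∑ i ∈ W, ∑ k ∈ W.erase i, lennardJones (dist (y i) (y k))

/-- Order 0 (LANDED, `card_mul_iInf_le_half_sum`): the internal energy of any sub-cluster of distinct points is `≥ #W·e⋆`. -/
theorem intEnergy_floor {N : ℕ} {y : Fin N → EuclideanSpace ℝ (Fin 3)} (hy : Function.Injective y) (W : Finset (Fin N)) :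
    (W.card : ℝ) * eStar ≤ intEnergy y W :=
  ContactSaturationLadderWindowFloor.card_mul_iInf_le_half_sum hy W

/-! ## §2 Species (cored / coreless) and the GS-free brush-and-shell count -/

/-- The CORED loose particles at brush radius `R`: (3/50)-loose with a 5-deep loose particle within `R`. -/
def coredSet (R : ℝ) {N : ℕ} (y : Fin N → EuclideanSpace ℝ (Fin 3)) : Finset (Fin N) :=
  (looseSet (3 / 50) y).filter fun j : Fin N => ∃ k : Fin N, k ∈ deepSet 5 y ∧ dist (y k) (y j) ≤ R

/-- The CORELESS loose particles at brush radius `R`: (3/50)-loose with NO 5-deep loose particle within `R`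
(`¬ ∃ k ∈ deepSet 5 y, dist (y k) (y j) ≤ R`, i.e. every 5-deep particle is farther than `R`). -/
def corelessSet (R : ℝ) {N : ℕ} (y : Fin N → EuclideanSpace ℝ (Fin 3)) : Finset (Fin N) :=
  (looseSet (3 / 50) y).filter fun j : Fin N => ¬ ∃ k : Fin N, k ∈ deepSet 5 y ∧ dist (y k) (y j) ≤ R

/-- Cored loose particles are loose. -/
theorem coredSet_subset (R : ℝ) {N : ℕ} (y : Fin N → EuclideanSpace ℝ (Fin 3)) : coredSet R y ⊆ looseSet (3 / 50) y :=
  Finset.filter_subset _ _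

/-- Coreless loose particles are loose. -/
theorem corelessSet_subset (R : ℝ) {N : ℕ} (y : Fin N → EuclideanSpace ℝ (Fin 3)) : corelessSet R y ⊆ looseSet (3 / 50) y :=
  Finset.filter_subset _ _

/-- Membership in the coreless set: loose, and no `5`-deep particle within `R`. -/
theorem mem_corelessSet_iff {R : ℝ} {N : ℕ} {y : Fin N → EuclideanSpace ℝ (Fin 3)} {j : Fin N} :
    j ∈ corelessSet R y ↔ j ∈ looseSet (3 / 50) y ∧ ∀ k : Fin N, k ∈ deepSet 5 y → R < dist (y k) (y j) := by
  simp only [corelessSet, Finset.mem_filter, not_exists, not_and, not_le]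

/-- The two species COUNT the loose particles of any window exactly. -/
theorem card_cored_add_coreless (R : ℝ) {N : ℕ} (y : Fin N → EuclideanSpace ℝ (Fin 3)) (P : Fin N → Prop) [DecidablePred P] :
    (((coredSet R y).filter P).card : ℝ) + (((corelessSet R y).filter P).card : ℝ) = (((looseSet (3 / 50) y).filter P).card : ℝ) := by
  have h := Finset.card_filter_add_card_filter_not (s := (looseSet (3 / 50) y).filter P)
    (fun j : Fin N => ∃ k : Fin N, k ∈ deepSet 5 y ∧ dist (y k) (y j) ≤ R)
  have h1 : ((looseSet (3 / 50) y).filter P).filter (fun j : Fin N => ∃ k : Fin N, k ∈ deepSet 5 y ∧ dist (y k) (y j) ≤ R)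
      = (coredSet R y).filter P := by
    ext j; simp only [coredSet, Finset.mem_filter]; tauto
  have h2 : ((looseSet (3 / 50) y).filter P).filter (fun j : Fin N => ¬ ∃ k : Fin N, k ∈ deepSet 5 y ∧ dist (y k) (y j) ≤ R)
      = (corelessSet R y).filter P := by
    ext j; simp only [corelessSet, Finset.mem_filter]; tauto
  rw [h1, h2] at h
  exact_mod_cast h

/-- The cored set grows with the core radius `R`. -/
theorem coredSet_mono {R R' : ℝ} (h : R ≤ R') (y : Fin N → EuclideanSpace ℝ (Fin 3)) : coredSet R y ⊆ coredSet R' y := by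
  intro j hj
  simp only [coredSet, Finset.mem_filter] at hj ⊢
  obtain ⟨hl, k, hk, hkj⟩ := hj
  exact ⟨hl, k, hk, le_trans hkj h⟩

/-- The coreless set shrinks as the core radius `R` grows. -/
theorem corelessSet_anti {R R' : ℝ} (h : R ≤ R') (y : Fin N → EuclideanSpace ℝ (Fin 3)) : corelessSet R' y ⊆ corelessSet R y := by
  intro j hj
  rw [mem_corelessSet_iff] at hj ⊢
  exact ⟨hj.1, fun k hk => lt_of_le_of_lt h (hj.2 k hk)⟩

/-- **Short pairs are 5-deep**: a particle with a partner closer than `3/4` is `r`-deep (3/50)-loose for every `r ≤ 5` (no centre within 5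
of it can be uniformly tight: the short pair lies in that centre's 6-ball). -/
theorem mem_deepSet_of_shortPair {r : ℝ} (hr : r ≤ 5) {N : ℕ} (y : Fin N → EuclideanSpace ℝ (Fin 3)) {k l : Fin N} (hkl : k ≠ l)
    (hd : dist (y k) (y l) < 3 / 4) : k ∈ deepSet r y := by
  have key : ∀ (m : Fin N) (d : ℝ), dist (y k) (y m) ≤ 5 → ¬ UniformlyTight (3 / 50) d y m := by
    intro m d hkm hUT
    obtain ⟨hd34, -, hpair, -⟩ := hUT
    have h1 : dist (y k) (y m) ≤ 6 := by linarith
    have h2 : dist (y l) (y m) ≤ 6 := by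
      have := dist_triangle (y l) (y k) (y m)
      rw [dist_comm (y l) (y k)] at this
      linarith
    have := hpair k l hkl h1 h2
    linarith
  simp only [deepSet, looseSet, Finset.mem_filter, Finset.mem_univ, true_and]
  refine ⟨fun d => key k d (by rw [dist_self]; norm_num), fun m hm d => key m d ?_⟩
  rw [dist_comm]; exact le_trans hm hr

/-- Non-5-deep particles are `3/4`-separated from every other particle (GS-free). -/
theorem sep_of_not_mem_deepSet5 {N : ℕ} (y : Fin N → EuclideanSpace ℝ (Fin 3)) {i l : Fin N} (hi : i ∉ deepSet 5 y) (hil : i ≠ l) :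
    3 / 4 ≤ dist (y i) (y l) := by
  by_contra h
  push Not at h
  exact hi (mem_deepSet_of_shortPair le_rfl y hil h)

/-- Cores are cored: `deepSet 5 ⊆ coredSet R` for `R ≥ 0`. -/
theorem deepSet5_subset_coredSet {R : ℝ} (hR : 0 ≤ R) {N : ℕ} (y : Fin N → EuclideanSpace ℝ (Fin 3)) : deepSet 5 y ⊆ coredSet R y := by
  intro k hk
  refine Finset.mem_filter.2 ⟨deepSet_subset_looseSet 5 y hk, k, hk, ?_⟩
  rw [dist_self]; exact hR

/-- **SHELL PACKING** (volume): `3/4`-separated particles in the shell `ρ − 6 < |x − p| ≤ ρ` (`ρ ≥ 9`) number at most `500 ρ²` — the open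
balls of radius `3/8` about them are disjoint, inside `B(p, ρ + 3/8)` and outside `B(p, ρ − 6 − 3/8)`. -/
theorem card_shell_le {N : ℕ} (y : Fin N → EuclideanSpace ℝ (Fin 3)) (S : Finset (Fin N)) (p : EuclideanSpace ℝ (Fin 3)) {ρ : ℝ}
    (hρ : 9 ≤ ρ) (hS : ∀ i ∈ S, ρ - 6 < dist (y i) p ∧ dist (y i) p ≤ ρ)
    (hsep : ∀ i ∈ S, ∀ j ∈ S, i ≠ j → 3 / 4 ≤ dist (y i) (y j)) : (S.card : ℝ) ≤ 500 * ρ ^ 2 := by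
  classical
  have hinj : Set.InjOn y ↑S := by
    intro i hi j hj hij
    by_contra hne
    have h := hsep i hi j hj hne
    rw [hij, dist_self] at h
    linarith
  have hcard : (S.image y).card = S.card := Finset.card_image_of_injOn hinj
  set s : Finset (EuclideanSpace ℝ (Fin 3)) := S.image y with hsdef
  have hs : ∀ c ∈ s, ρ - 6 < dist c p ∧ dist c p ≤ ρ := by
    intro c hc
    obtain ⟨i, hi, rfl⟩ := Finset.mem_image.1 hc
    exact hS i hi
  have hsd : ∀ c ∈ s, ∀ d ∈ s, c ≠ d → 3 / 4 ≤ dist c d := by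
    intro c hc d hd hcd
    obtain ⟨i, hi, rfl⟩ := Finset.mem_image.1 hc
    obtain ⟨j, hj, rfl⟩ := Finset.mem_image.1 hd
    exact hsep i hi j hj fun h => hcd (by rw [h])
  -- volumes
  set v1 : ℝ := (volume : Measure (EuclideanSpace ℝ (Fin 3))).real (ball 0 1) with hv1
  have hv1pos : 0 < v1 := ENNReal.toReal_pos (measure_ball_pos volume _ one_pos).ne' measure_ball_lt_top.ne
  have hvball : ∀ (c : EuclideanSpace ℝ (Fin 3)) (r : ℝ), 0 ≤ r →
      (volume : Measure (EuclideanSpace ℝ (Fin 3))).real (ball c r) = r ^ 3 * v1 := by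
    intro c r hr
    rw [← Measure.addHaar_real_closedBall_eq_addHaar_real_ball volume c r, Measure.addHaar_real_closedBall volume c hr,
      finrank_euclideanSpace_fin]
  set A : Set (EuclideanSpace ℝ (Fin 3)) := ⋃ c ∈ s, ball c (3 / 8) with hAdef
  have hdisj : Set.PairwiseDisjoint (↑s : Set (EuclideanSpace ℝ (Fin 3))) (fun c => ball c (3 / 8 : ℝ)) := by
    intro c hc d hd hcd
    apply ball_disjoint_ball
    have := hsd c hc d hd hcd
    linarith
  have hA : (volume : Measure (EuclideanSpace ℝ (Fin 3))).real A = (s.card : ℝ) * ((3 / 8 : ℝ) ^ 3 * v1) := by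
    rw [hAdef, measureReal_biUnion_finset hdisj fun c _ => measurableSet_ball]
    simp only [hvball _ (3 / 8 : ℝ) (by norm_num), Finset.sum_const, nsmul_eq_mul]
  have hρm : 0 ≤ ρ - 6 - 3 / 8 := by linarith
  have hρp : 0 ≤ ρ + 3 / 8 := by linarith
  have hAsub : A ⊆ ball p (ρ + 3 / 8) := by
    refine Set.iUnion₂_subset fun c hc => ball_subset_ball' ?_
    have := (hs c hc).2
    linarith
  have hAin : Disjoint A (ball p (ρ - 6 - 3 / 8)) := by
    rw [Set.disjoint_left]
    intro z hzA hzB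
    obtain ⟨c, hc, hzc⟩ := Set.mem_iUnion₂.1 hzA
    rw [mem_ball] at hzc hzB
    have h1 := (hs c hc).1
    have h2 := dist_triangle c z p
    rw [dist_comm c z] at h2
    linarith
  have hU : (volume : Measure (EuclideanSpace ℝ (Fin 3))).real (A ∪ ball p (ρ - 6 - 3 / 8))
      ≤ (volume : Measure (EuclideanSpace ℝ (Fin 3))).real (ball p (ρ + 3 / 8)) :=
    measureReal_mono (Set.union_subset hAsub (ball_subset_ball (by linarith)))
  have hAfin : (volume : Measure (EuclideanSpace ℝ (Fin 3))) A ≠ ⊤ :=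
    ((measure_mono hAsub).trans_lt measure_ball_lt_top).ne
  rw [measureReal_union hAin measurableSet_ball hAfin, hA, hvball p _ hρm, hvball p _ hρp] at hU
  -- divide by v1 and finish with arithmetic
  have hmain : (s.card : ℝ) * (3 / 8 : ℝ) ^ 3 + (ρ - 6 - 3 / 8) ^ 3 ≤ (ρ + 3 / 8) ^ 3 := by
    have := hU
    have h' : ((s.card : ℝ) * (3 / 8 : ℝ) ^ 3 + (ρ - 6 - 3 / 8) ^ 3) * v1 ≤ (ρ + 3 / 8) ^ 3 * v1 := by nlinarith
    exact le_of_mul_le_mul_right h' hv1pos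
  rw [← hcard]
  nlinarith

/-- **GS-free BRUSH-AND-SHELL COUNT**: in any ball `B(p,ρ)` (`ρ ≥ 9`) of ANY configuration, the cored loose
particles at brush radius 6 number at most `4914·#{5-deep in B(p,ρ)} + 500·ρ²` (non-deep particles are 3/4-separated; those deeper than 6 inside
the ball are brushed by the ball's own cores, those in the outer shell are volume-packed). -/
theorem card_cored6_le (y : Fin N → EuclideanSpace ℝ (Fin 3)) (p : EuclideanSpace ℝ (Fin 3)) {ρ : ℝ} (hρ : 9 ≤ ρ) :
    (((coredSet 6 y).filter fun i : Fin N => dist (y i) p ≤ ρ).card : ℝ)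
      ≤ 4914 * (((deepSet 5 y).filter fun i : Fin N => dist (y i) p ≤ ρ).card : ℝ) + 500 * ρ ^ 2 := by
  set X : Finset (Fin N) := (deepSet 5 y).filter fun i : Fin N => dist (y i) p ≤ ρ with hX
  set Kc : Finset (Fin N) := (coredSet 6 y).filter fun i : Fin N => dist (y i) p ≤ ρ with hKc
  set Y : Finset (Fin N) := Kc.filter fun i : Fin N => i ∉ deepSet 5 y ∧ dist (y i) p ≤ ρ - 6 with hY
  set Z : Finset (Fin N) := Kc.filter fun i : Fin N => i ∉ deepSet 5 y ∧ ρ - 6 < dist (y i) p with hZ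
  have hcover : Kc ⊆ X ∪ (Y ∪ Z) := by
    intro i hi
    have hi' := Finset.mem_filter.1 hi
    by_cases hdeep : i ∈ deepSet 5 y
    · exact Finset.mem_union_left _ (Finset.mem_filter.2 ⟨hdeep, hi'.2⟩)
    · by_cases hin : dist (y i) p ≤ ρ - 6
      · exact Finset.mem_union_right _ (Finset.mem_union_left _ (Finset.mem_filter.2 ⟨hi, hdeep, hin⟩))
      · exact Finset.mem_union_right _ (Finset.mem_union_right _ (Finset.mem_filter.2 ⟨hi, hdeep, lt_of_not_ge hin⟩))
  have hKle : (Kc.card : ℝ) ≤ X.card + (Y.card + Z.card) := by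
    have h1 := Finset.card_le_card hcover
    have h2 := Finset.card_union_le X (Y ∪ Z)
    have h3 := Finset.card_union_le Y Z
    exact_mod_cast h1.trans (h2.trans (Nat.add_le_add_left h3 _))
  have hYle : (Y.card : ℝ) ≤ (2 * 6 / (3 / 4) + 1) ^ 3 * X.card := by
    refine ContactSaturationLadderHoleDepth.card_le_mul_card_of_brushed y Y X (by norm_num) (by norm_num) ?_ ?_
    · intro i hi j hj hij
      exact sep_of_not_mem_deepSet5 y (Finset.mem_filter.1 hi).2.1 hij
    · intro i hi
      obtain ⟨hiK, hind, hin⟩ := Finset.mem_filter.1 hi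
      obtain ⟨-, k, hk, hki⟩ := Finset.mem_filter.1 (Finset.mem_filter.1 hiK).1
      refine ⟨k, Finset.mem_filter.2 ⟨hk, ?_⟩, by rw [dist_comm]; exact hki⟩
      have := dist_triangle (y k) (y i) p
      linarith
  have hZle : (Z.card : ℝ) ≤ 500 * ρ ^ 2 := by
    refine card_shell_le y Z p hρ ?_ ?_
    · intro i hi
      obtain ⟨hiK, -, hout⟩ := Finset.mem_filter.1 hi
      exact ⟨hout, (Finset.mem_filter.1 hiK).2⟩
    · intro i hi j hj hij
      exact sep_of_not_mem_deepSet5 y (Finset.mem_filter.1 hi).2.1 hij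
  have h17 : (2 * 6 / (3 / 4) + 1 : ℝ) ^ 3 = 4913 := by norm_num
  rw [h17] at hYle
  have hX0 : (0 : ℝ) ≤ X.card := Nat.cast_nonneg _
  linarith

end Summit.AtomisticToContinuum.Crystallization.Theorems.ContactSaturationLadderHaloCount
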